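import Summits.KontsevichZagierPeriods.KontsevichZagierPeriods.Theorems.HermiteRigidityReductionRigidityLineBase
import Summits.KontsevichZagierPeriods.KontsevichZagierPeriods.Theorems.HermiteRigidityReductionRigidityLineDescent
import Literature.NumberTheory.Transcendental.KZCubeRationalMoves

/-!
# KontsevichZagierPeriods / HermiteRigidity — crux `ReductionRigidity` (stmt-KontsevichZagierPeriods-3407), line `Sketch` (Padé box island): the LINE reduction

Route `KontsevichZagierPeriods/HermiteRigidity`, crux stmt-KontsevichZagierPeriods-3407 (`ReductionRigidity`),
crux-chain line `Sketch` = the `(w ≤ 2, 1/N)` box island of the idea card `pade-box-islands`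
(skeleton `Cruxes/ReductionRigidity/Lines/Sketch.lean`). Glue of the lead over the two landed worker
stubs `stub_lineBase` (pure powers) and `stub_lineDescent` (`x = N − (N − x)` + monomials):

* `lineReduction` — for every integer `N ≥ 2`, every RESCALED line generator on the closed unit interval
  `□¹ = [0,1]` reduces modulo `KZ.relations` to the two normal forms with RATIONAL coefficients,
  `[□¹, q·x^c/(N − x)^m] ≡ [□¹, β/(N − x)] + [pt, γ]` (`β, γ ∈ ℚ`; values `β·Li₁(1/N) + γ`), by induction
  on the exponent `c`;
* the small shared toolkit of the island files: existence of the generators / normal forms as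
  representations of regular rational functions on the cube (`KZ.RFun`), and the rule-1b bookkeeping of
  one-parameter carrier families (`carrier_add`, `carrier_zero`).

All moves are cubical moves with rational primitives regular on the closed cube; nothing is integrated
out. Downstream: `HermiteRigidityReductionRigidityBoxTwoReduction.lean` (the box reduction) and
`HermiteRigidityReductionRigidityPadeBoxIslands.lean` (the island theorems).

References: M. Kontsevich, D. Zagier, *Periods* (2001), §1.2 [cite: KontsevichZagier2001, §1.2];
J. Ayoub, *Periods and the conjectures of Grothendieck and Kontsevich–Zagier* (2014), Def. 10 (the
cubical Stokes relation) [cite: Ayoub2014, Def. 10].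
-/

noncomputable section

open MeasureTheory Set MvPolynomial

namespace Summit.KontsevichZagierPeriods.HermiteRigidity.ReductionRigidity

open Literature.NumberTheory.Transcendental
open Literature.NumberTheory.Transcendental.KZ

/-! ## Toolkit: representations, carrier bookkeeping -/

/-- The rescaled line generator `[□¹, q x^c/(N−x)^m]` exists (a regular rational function on the
closed interval). [cite: KontsevichZagier2001, §1.1] -/
theorem exists_lineRep {N : ℕ} (hN : 2 ≤ N) (q : ℚ) (c m : ℕ) :
    ∃ r : IntegralRep 1, r.domain = cube 1 ∧
      EqOn r.integrand (fun p => (q : ℝ) * p 0 ^ c / ((N : ℝ) - p 0) ^ m) (cube 1) := by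
  refine ⟨(⟨C q * X 0 ^ c, (C (N : ℚ) - X 0) ^ m, lineBase_den_ne hN m⟩ : RFun 1).rep, rfl, fun x _ => ?_⟩
  simp [RFun.rep_integrand, RFun.fn]

/-- The line normal form `[□¹, β/(N−x)]` exists. [cite: KontsevichZagier2001, §1.1] -/
theorem exists_nf1 {N : ℕ} (hN : 2 ≤ N) (β : ℚ) :
    ∃ s : IntegralRep 1, s.domain = cube 1 ∧
      EqOn s.integrand (fun p => (β : ℝ) / ((N : ℝ) - p 0)) (cube 1) := by
  refine ⟨(⟨C β, (C (N : ℚ) - X 0) ^ 1, lineBase_den_ne hN 1⟩ : RFun 1).rep, rfl, fun x _ => ?_⟩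
  simp [RFun.rep_integrand, RFun.fn]

/-- The rational constant `[pt, γ]` exists in dimension `0`. [cite: KontsevichZagier2001, §1.1] -/
theorem exists_nf0 (γ : ℚ) :
    ∃ s : IntegralRep 0, s.domain = cube 0 ∧ EqOn s.integrand (fun _ => (γ : ℝ)) (cube 0) :=
  ⟨(RFun.const γ : RFun 0).rep, rfl, fun x _ => by simp [RFun.rep_integrand]⟩

/-- Additivity of a one-parameter family of carriers with a common domain (rule 1b): if
`s, s', s''` carry `f β, f β', f (β + β')` with `f` additive in the parameter, then
`[s''] − [s] − [s'] ∈ relations`. [cite: KontsevichZagier2001, §1.2 rule (1)] -/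
theorem carrier_add {n : ℕ} {D : Set (Fin n → ℝ)} (f : ℚ → (Fin n → ℝ) → ℝ)
    (hf : ∀ β β' x, f (β + β') x = f β x + f β' x) {β β' : ℚ} {s s' s'' : IntegralRep n}
    (hs : s.domain = D) (hsi : EqOn s.integrand (f β) D) (hs' : s'.domain = D)
    (hsi' : EqOn s'.integrand (f β') D) (hs'' : s''.domain = D) (hsi'' : EqOn s''.integrand (f (β + β')) D) :
    KZ.of s'' - KZ.of s - KZ.of s' ∈ KZ.relations := by
  refine integrandAddRel_subset_relations ⟨n, s'', s, s', hs.trans hs''.symm, hs'.trans hs''.symm,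
    fun x hx => ?_, rfl⟩
  rw [hs''] at hx
  rw [Pi.add_apply, hsi'' hx, hsi hx, hsi' hx, hf]

/-- A carrier with parameter `0` (zero integrand on its domain) is a relation.
[cite: KontsevichZagier2001, §1.2 rule (1)] -/
theorem carrier_zero {n : ℕ} {D : Set (Fin n → ℝ)} (f : ℚ → (Fin n → ℝ) → ℝ) (hf0 : ∀ x, f 0 x = 0)
    {s : IntegralRep n} (hs : s.domain = D) (hsi : EqOn s.integrand (f 0) D) :
    KZ.of s ∈ KZ.relations :=
  of_mem_relations_of_eqOn_zero s fun x hx => by rw [hs] at hx; rw [hsi hx, hf0]; rfl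

/-- The three normal-form integrand families, additive in the rational parameter. [folklore] -/
theorem nf_families_additive (N : ℕ) :
    (∀ β β' : ℚ, ∀ x : Fin 2 → ℝ, (((β + β' : ℚ) : ℝ) / ((N : ℝ) - x 0 * x 1)) =
        (β : ℝ) / ((N : ℝ) - x 0 * x 1) + (β' : ℝ) / ((N : ℝ) - x 0 * x 1)) ∧
    (∀ β β' : ℚ, ∀ x : Fin 1 → ℝ, (((β + β' : ℚ) : ℝ) / ((N : ℝ) - x 0)) =
        (β : ℝ) / ((N : ℝ) - x 0) + (β' : ℝ) / ((N : ℝ) - x 0)) ∧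
    (∀ β β' : ℚ, ∀ _x : Fin 0 → ℝ, (((β + β' : ℚ) : ℝ)) = (β : ℝ) + (β' : ℝ)) := by
  refine ⟨fun β β' x => ?_, fun β β' x => ?_, fun β β' x => ?_⟩ <;> push_cast <;> ring

/-! ## The line reduction -/

/-- **The line reduction** (glue over `stub_lineBase` + `stub_lineDescent`, induction on the
exponent `c`): every rescaled line generator reduces to the normal forms with rational
coefficients, `[□¹, q x^c/(N−x)^m] ≡ [□¹, β/(N−x)] + [pt, γ]`.
[cite: KontsevichZagier2001, §1.2] -/
theorem lineReduction {N : ℕ} (hN : 2 ≤ N) : ∀ (c : ℕ) (q : ℚ) (m : ℕ) (r : IntegralRep 1),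
    r.domain = cube 1 → EqOn r.integrand (fun p => (q : ℝ) * p 0 ^ c / ((N : ℝ) - p 0) ^ m) (cube 1) →
    ∃ (β γ : ℚ) (s₁ : IntegralRep 1) (s₀ : IntegralRep 0),
      s₁.domain = cube 1 ∧ EqOn s₁.integrand (fun p => (β : ℝ) / ((N : ℝ) - p 0)) (cube 1) ∧
      s₀.domain = cube 0 ∧ EqOn s₀.integrand (fun _ => (γ : ℝ)) (cube 0) ∧
      KZ.of r - (KZ.of s₁ + KZ.of s₀) ∈ KZ.relations := by
  intro c
  induction c with
  | zero =>
    intro q m r hr hri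
    exact stub_lineBase N hN q m r hr fun x hx => by rw [hri hx]; simp
  | succ c ih =>
    intro q m r hr hri
    cases m with
    | zero =>
      -- a monomial: `[□¹, q x^{c+1}] ≡ [pt, q/(c+2)]`, plus the zero line normal form
      obtain ⟨s₀, hs₀, hs₀i⟩ := exists_nf0 (q / ((c + 1 : ℕ) + 1))
      obtain ⟨s₁, hs₁, hs₁i⟩ := exists_nf1 hN 0
      have hmono := stub_lineDescent.2 q (c + 1) r s₀ hr (fun x hx => by rw [hri hx]; simp) hs₀
        (fun x hx => by rw [hs₀i hx])
      have hz : KZ.of s₁ ∈ KZ.relations :=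
        carrier_zero (D := cube 1) (fun β x => (β : ℝ) / ((N : ℝ) - x 0)) (fun x => by simp) hs₁ hs₁i
      refine ⟨0, q / ((c + 1 : ℕ) + 1), s₁, s₀, hs₁, hs₁i, hs₀, hs₀i, ?_⟩
      have : KZ.of r - (KZ.of s₁ + KZ.of s₀) = (KZ.of r - KZ.of s₀) - KZ.of s₁ := by abel
      rw [this]
      exact KZ.relations.sub_mem hmono hz
    | succ m =>
      -- descent `x = N − (N − x)`, then the induction hypothesis twice
      obtain ⟨r₁, hr₁, hr₁i⟩ := exists_lineRep hN (q * N) c (m + 1)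
      obtain ⟨r₂, hr₂, hr₂i⟩ := exists_lineRep hN q c m
      have hdesc := stub_lineDescent.1 N hN q c m r r₁ r₂ hr hri hr₁ hr₁i hr₂ hr₂i
      obtain ⟨β₁, γ₁, s₁, t₁, hs₁, hs₁i, ht₁, ht₁i, h₁⟩ := ih (q * N) (m + 1) r₁ hr₁ hr₁i
      obtain ⟨β₂, γ₂, s₂, t₂, hs₂, hs₂i, ht₂, ht₂i, h₂⟩ := ih q m r₂ hr₂ hr₂i
      obtain ⟨s, hs, hsi⟩ := exists_nf1 hN (β₁ - β₂)
      obtain ⟨t, ht, hti⟩ := exists_nf0 (γ₁ - γ₂)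
      obtain ⟨hA2, hA1, hA0⟩ := nf_families_additive N
      -- `[s(β₁)] − [s(β₁−β₂)] − [s(β₂)]`, `[t(γ₁)] − [t(γ₁−γ₂)] − [t(γ₂)]` are relations
      have hs' := carrier_add (D := cube 1) (fun β x => (β : ℝ) / ((N : ℝ) - x 0)) hA1
        (β := β₁ - β₂) (β' := β₂) hs hsi hs₂ hs₂i hs₁ (fun x hx => by rw [hs₁i hx, sub_add_cancel])
      have ht' := carrier_add (D := cube 0) (fun β _ => (β : ℝ)) hA0
        (β := γ₁ - γ₂) (β' := γ₂) ht hti ht₂ ht₂i ht₁ (fun x hx => by rw [ht₁i hx, sub_add_cancel])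
      refine ⟨β₁ - β₂, γ₁ - γ₂, s, t, hs, hsi, ht, hti, ?_⟩
      have : KZ.of r - (KZ.of s + KZ.of t) =
          (KZ.of r - (KZ.of r₁ - KZ.of r₂)) + (KZ.of r₁ - (KZ.of s₁ + KZ.of t₁))
            - (KZ.of r₂ - (KZ.of s₂ + KZ.of t₂))
            + (KZ.of s₁ - KZ.of s - KZ.of s₂) + (KZ.of t₁ - KZ.of t - KZ.of t₂) := by abel
      rw [this]
      exact KZ.relations.add_mem (KZ.relations.add_mem (KZ.relations.sub_mem
        (KZ.relations.add_mem hdesc h₁) h₂) hs') ht'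

/-- **Registered form** of `lineReduction` (crux stub `stub_lineReduction`, `N` quantified first).
[cite: KontsevichZagier2001, §1.2] -/
theorem stub_lineReduction : ∀ (N : ℕ), 2 ≤ N → ∀ (c : ℕ) (q : ℚ) (m : ℕ) (r : IntegralRep 1),
    r.domain = cube 1 → EqOn r.integrand (fun p => (q : ℝ) * p 0 ^ c / ((N : ℝ) - p 0) ^ m) (cube 1) →
    ∃ (β γ : ℚ) (s₁ : IntegralRep 1) (s₀ : IntegralRep 0),
      s₁.domain = cube 1 ∧ EqOn s₁.integrand (fun p => (β : ℝ) / ((N : ℝ) - p 0)) (cube 1) ∧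
      s₀.domain = cube 0 ∧ EqOn s₀.integrand (fun _ => (γ : ℝ)) (cube 0) ∧
      KZ.of r - (KZ.of s₁ + KZ.of s₀) ∈ KZ.relations :=
  fun _ hN => lineReduction hN

end Summit.KontsevichZagierPeriods.HermiteRigidity.ReductionRigidity

end
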